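import Literature.AlgebraicGeometry.Motives.SupersingularAbelianVarietyProofs
import Literature.AlgebraicGeometry.Motives.CorrespondencesTraceFormula
import HarnessLib

/-!
# Künneth classes of endomorphisms of `Hⁱ(X)`, and algebraic divisor classes on products

Formal consequences of the axioms of a Weil cohomology theory `W : WeilCohomology k K`
(Kleiman, *Algebraic cycles and the Weil conjectures* (1968), §1.2–1.3), continuing
`CorrespondencesTraceFormula` (Poincaré dual classes `ofDualRight`, the Künneth diagonal) towards
the Lenstra–Zarhin / Tate argument for products of a curve with itself
(`Motives/SupersingularAbelianVariety`): on `E × E` the graph classes of the endomorphisms of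
`E` supply the divisor classes of Künneth type `(1,1)`.

* `WeilCohomology.trace_endClass_cup_externalCup`, `…_of_ne`: for an endomorphism `G` of `Hⁱ(X)`
  and a basis `b` of `Hⁱ(X)` with Poincaré-dual classes `bˢ ∈ Hʲ(X)` (`i + j = 2 dim X`), the
  **Künneth class of `G`**, `K_b(G) = Σₛ pr₁* bˢ ∪ pr₂* G(bₛ) ∈ H²ⁿ(X × X)`, pairs with external
  products like the correspondence inducing `G`:
  `tr_{X×X}(K_b(G) ∪ (pr₁* x ∪ pr₂* y)) = tr_X(G x ∪ y)`
  for `x ∈ Hⁱ(X)` and `= 0` for `x` of other degrees (Kleiman 1968, proof of Prop. 1.3.6; Kahn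
  2020, §3.5, `(v ⊗ w)(x) = ⟨x, v⟩ w`);
* `WeilCohomology.eq_endClass_add_of_isInducedBy_one`: on a smooth projective **curve** `X`, a
  class `u ∈ H²(X × X)` inducing `G_a` on `Hᵃ(X)` for `a = 0, 1, 2` (as the class of the
  transposed graph of `f : X → X` induces `f*`, axiom `exists_isInducedBy_pullback`) **is**
  `K(G₀) + K(G₁) + K(G₂)` (Poincaré duality on `X × X` and Künneth induction; the curve case of
  the Künneth decomposition of a correspondence);
* `WeilCohomology.externalCup_one_left/right`, `externalCup_mem_algebraicClasses_of_deg_zero_left/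
  right`: `pr₁* 1 ∪ pr₂* z = pr₂* z`, so external products with a degree-zero factor are pulled
  back from a factor and are algebraic when the other factor is;
* `WeilCohomology.exists_eq_pullback_add_pullback`: `H¹(X × Y) = pr₁* H¹(X) + pr₂* H¹(Y)`;
  `WeilCohomology.algebraicClasses_tensor_one_eq_top`: **the divisor classes span `H²(X × Y)` as
  soon as they span `H²(X)`, `H²(Y)` and contain the external products `pr₁* x ∪ pr₂* y` of
  degree-one classes** (Künneth in degree `2`).

Everything is a theorem with a real proof from the fields of `WeilCohomology`; no definitions, no
named facts.

## References

* [Kleiman1968] S. Kleiman, *Algebraic cycles and the Weil conjectures*, Dix exposés (1968),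
  §1.2 (axioms), §1.3 (correspondences), proof of Prop. 1.3.6.
* [Kahn2020] B. Kahn, *Zeta and L-functions of varieties and motives* (2020), §3.5.
-/

universe u v

open CategoryTheory AlgebraicGeometry MonoidalCategory CartesianMonoidalCategory Opposite
open scoped TensorProduct

noncomputable section

namespace Literature.AlgebraicGeometry.Motives

namespace WeilCohomology

variable {k : Type u} [Field k] {K : Type v} [Field K] [CharZero K] (W : WeilCohomology k K)

/-! ## The Künneth class of an endomorphism of `Hⁱ(X)` -/

section EndClass

variable {n : ℕ} {X : SchemeOver k} {ι : Type*} [Fintype ι]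

/-- **Pairing of the Künneth class of `G` with external products, matching degree.** For a basis
`b` of `Hⁱ(X)` with Poincaré duals `bˢ = ofDualRight (b.coord s) ∈ Hʲ(X)` and
`G ∈ End Hⁱ(X)`: `tr_{X×X}((Σₛ pr₁* bˢ ∪ pr₂* G bₛ) ∪ (pr₁* x ∪ pr₂* y)) = tr_X(G x ∪ y)` for
`x ∈ Hⁱ(X)`, `y ∈ Hʲ(X)` (the Koszul signs `(-1)^{i·i} (-1)^{j·i} = (-1)^{2n·i}` cancel).
[cite: Kleiman1968, Prop. 1.3.6 (proof)] -/
theorem trace_endClass_cup_externalCup (hX : IsSmoothProjective n X) {i j : ℕ}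
    (h : i + j = 2 * n) (h' : j + i = 2 * n) (b : Module.Basis ι K (W.obj X i))
    (G : W.obj X i →ₗ[K] W.obj X i) (H : 2 * n + 2 * n = 2 * (n + n)) (x : W.obj X i)
    (y : W.obj X j) :
    W.trace (X ⊗ X) (n + n) (W.cup H
        (∑ s, W.externalCup X X h' (W.ofDualRight hX h (b.coord s)) (G (b s)))
        (W.externalCup X X h x y)) =
      W.trace X n (W.cup h (G x) y) := by
  classical
  simp only [map_sum, LinearMap.sum_apply]
  have hsign : ((((i : ℤ) * i).negOnePow : ℤ) : K) * ((((j : ℤ) * i).negOnePow : ℤ) : K) = 1 := by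
    rw [cast_negOnePow_mul, Int.negOnePow_even _
        ⟨n * i, by rw [← add_mul, ← Nat.cast_add, h]; push_cast; ring⟩,
      Units.val_one, Int.cast_one]
  have hterm : ∀ s, W.trace (X ⊗ X) (n + n) (W.cup H
      (W.externalCup X X h' (W.ofDualRight hX h (b.coord s)) (G (b s))) (W.externalCup X X h x y)) =
      b.repr x s * W.trace X n (W.cup h (G (b s)) y) := by
    intro s
    rw [W.cup_externalCup_externalCup hX hX h' h H h' h H, LinearMap.map_smul_of_tower,
      W.trace_externalCup' hX hX H, W.trace_cup_comm hX h' h _ x, ← cupPairing_apply,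
      cupPairing_ofDualRight, Module.Basis.coord_apply, zsmul_eq_mul, zsmul_eq_mul, ← mul_assoc,
      ← mul_assoc, hsign, one_mul]
  simp_rw [hterm]
  have hlin : W.trace X n (W.cup h (G x) y) =
      ∑ s, b.repr x s * W.trace X n (W.cup h (G (b s)) y) := by
    conv_lhs => rw [← b.sum_repr x]
    simp only [map_sum, map_smul, LinearMap.sum_apply, LinearMap.smul_apply, smul_eq_mul]
  rw [hlin]

/-- **Pairing of the Künneth class of `G` with external products, other degrees**: for
`x ∈ Hᵃ(X)` with `a ≠ i` the pairing vanishes (the first factor `bˢ ∪ x` misses the top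
degree). [cite: Kleiman1968, Prop. 1.3.6 (proof)] -/
theorem trace_endClass_cup_externalCup_of_ne (hX : IsSmoothProjective n X) {i j : ℕ}
    (h : i + j = 2 * n) (h' : j + i = 2 * n) (b : Module.Basis ι K (W.obj X i))
    (G : W.obj X i →ₗ[K] W.obj X i) (H : 2 * n + 2 * n = 2 * (n + n)) {a a' : ℕ}
    (ha : a + a' = 2 * n) (hai : a ≠ i) (x : W.obj X a) (y : W.obj X a') :
    W.trace (X ⊗ X) (n + n) (W.cup H
        (∑ s, W.externalCup X X h' (W.ofDualRight hX h (b.coord s)) (G (b s)))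
        (W.externalCup X X ha x y)) = 0 := by
  classical
  simp only [map_sum, LinearMap.sum_apply]
  refine Finset.sum_eq_zero fun s _ ↦ ?_
  rw [W.cup_externalCup_externalCup hX hX h' ha H rfl rfl (by omega), LinearMap.map_smul_of_tower,
    W.externalCup_eq_zero_of_ne hX hX _ (by omega), map_zero, smul_zero]

/-- **The Künneth decomposition of a correspondence on a curve.** For `X` smooth projective of
dimension `1`, bases `b₀, b₁, b₂` of `H⁰, H¹, H²` and a class `u ∈ H²(X × X)` inducing
`G_a ∈ End Hᵃ(X)` for `a = 0, 1, 2` (Kleiman's pairing form `IsInducedBy`),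
`u = K_{b₀}(G₀) + K_{b₁}(G₁) + K_{b₂}(G₂)` with `K_b(G) = Σₛ pr₁* bˢ ∪ pr₂* G bₛ`: both sides have
the same Poincaré pairings with all external products (`kunneth_induction`,
`ext_cupPairing_left`). [cite: Kleiman1968, Prop. 1.3.6 (proof)] -/
theorem eq_endClass_add_of_isInducedBy_one (hX : IsSmoothProjective 1 X)
    {ι₀ ι₁ ι₂ : Type*} [Fintype ι₀] [Fintype ι₁] [Fintype ι₂]
    (b₀ : Module.Basis ι₀ K (W.obj X 0)) (b₁ : Module.Basis ι₁ K (W.obj X 1))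
    (b₂ : Module.Basis ι₂ K (W.obj X 2)) {u : W.obj (X ⊗ X) (2 * 1)}
    (G₀ : W.obj X 0 →ₗ[K] W.obj X 0) (G₁ : W.obj X 1 →ₗ[K] W.obj X 1)
    (G₂ : W.obj X 2 →ₗ[K] W.obj X 2)
    (h₀ : W.IsInducedBy 1 1 u G₀ (show 0 + 2 = 2 * 1 by rfl)
      (show 0 + 2 * 1 + 2 = 2 * (1 + 1) by rfl))
    (h₁ : W.IsInducedBy 1 1 u G₁ (show 1 + 1 = 2 * 1 by rfl)
      (show 1 + 2 * 1 + 1 = 2 * (1 + 1) by rfl))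
    (h₂ : W.IsInducedBy 1 1 u G₂ (show 2 + 0 = 2 * 1 by rfl)
      (show 2 + 2 * 1 + 0 = 2 * (1 + 1) by rfl)) :
    u = (∑ s, W.externalCup X X (show 2 + 0 = 2 * 1 by rfl)
          (W.ofDualRight hX (show 0 + 2 = 2 * 1 by rfl) (b₀.coord s)) (G₀ (b₀ s))) +
      (∑ s, W.externalCup X X (show 1 + 1 = 2 * 1 by rfl)
          (W.ofDualRight hX (show 1 + 1 = 2 * 1 by rfl) (b₁.coord s)) (G₁ (b₁ s))) +
      (∑ s, W.externalCup X X (show 0 + 2 = 2 * 1 by rfl)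
          (W.ofDualRight hX (show 2 + 0 = 2 * 1 by rfl) (b₂.coord s)) (G₂ (b₂ s))) := by
  have hXX := isSmoothProjective_tensor hX hX
  have H : 2 * 1 + 2 * 1 = 2 * (1 + 1) := rfl
  refine W.ext_cupPairing_left hXX H fun w ↦ ?_
  simp only [cupPairing_apply]
  induction w using W.kunneth_induction hX hX with
  | zero => simp
  | add w w' hw hw' => simp only [map_add, hw, hw']
  | ext a a' ha x y =>
    rw [map_add, map_add, LinearMap.add_apply, LinearMap.add_apply, map_add, map_add]
    obtain rfl | rfl | rfl : a = 0 ∨ a = 1 ∨ a = 2 := by omega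
    · obtain rfl : a' = 2 := by omega
      rw [W.trace_cup_externalCup_of_isInducedBy hX _ h₀ H x y,
        W.trace_endClass_cup_externalCup hX _ _ b₀ G₀ H x y,
        W.trace_endClass_cup_externalCup_of_ne hX _ _ b₁ G₁ H ha (by omega) x y,
        W.trace_endClass_cup_externalCup_of_ne hX _ _ b₂ G₂ H ha (by omega) x y, add_zero, add_zero]
    · obtain rfl : a' = 1 := by omega
      rw [W.trace_cup_externalCup_of_isInducedBy hX _ h₁ H x y,
        W.trace_endClass_cup_externalCup_of_ne hX _ _ b₀ G₀ H ha (by omega) x y,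
        W.trace_endClass_cup_externalCup hX _ _ b₁ G₁ H x y,
        W.trace_endClass_cup_externalCup_of_ne hX _ _ b₂ G₂ H ha (by omega) x y, zero_add, add_zero]
    · obtain rfl : a' = 0 := by omega
      rw [W.trace_cup_externalCup_of_isInducedBy hX _ h₂ H x y,
        W.trace_endClass_cup_externalCup_of_ne hX _ _ b₀ G₀ H ha (by omega) x y,
        W.trace_endClass_cup_externalCup_of_ne hX _ _ b₁ G₁ H ha (by omega) x y,
        W.trace_endClass_cup_externalCup hX _ _ b₂ G₂ H x y, zero_add, zero_add]

end EndClass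

/-! ## External products with a degree-zero factor; Künneth in degrees one and two -/

section Products

variable {n m : ℕ} {X Y : SchemeOver k}

/-- `pr₁* 1 ∪ pr₂* z = pr₂* z` (`map_one`, `one_cup`). [folklore] -/
theorem externalCup_one_left (hX : IsSmoothProjective n X) (hY : IsSmoothProjective m Y) {d : ℕ}
    (h : 0 + d = d) (z : W.obj Y d) :
    W.externalCup X Y h (W.one X) z = W.pullback (snd X Y) d z := by
  have hXY := isSmoothProjective_tensor hX hY
  rw [externalCup_apply, W.map_one hXY hX (fst X Y), W.one_cup hXY h]

/-- `pr₁* x ∪ pr₂* 1 = pr₁* x` (`map_one`, `cup_one`). [folklore] -/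
theorem externalCup_one_right (hX : IsSmoothProjective n X) (hY : IsSmoothProjective m Y) {d : ℕ}
    (h : d + 0 = d) (x : W.obj X d) :
    W.externalCup X Y h x (W.one Y) = W.pullback (fst X Y) d x := by
  have hXY := isSmoothProjective_tensor hX hY
  rw [externalCup_apply, W.map_one hXY hY (snd X Y), W.cup_one hXY h]

/-- An external product with a degree-zero left factor is algebraic when its right factor is:
`pr₁* (t • 1) ∪ pr₂* z = t • pr₂* z` (Kleiman 1968, §1.2 (C): pull-backs of algebraic classes
are algebraic). [cite: Kleiman1968, §1.2 (C)] -/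
theorem externalCup_mem_algebraicClasses_of_deg_zero_left (hX : IsSmoothProjective n X)
    (hY : IsSmoothProjective m Y) {p : ℕ} (h : 0 + 2 * p = 2 * p) (x : W.obj X 0)
    {z : W.obj Y (2 * p)} (hz : z ∈ W.algebraicClasses Y p) :
    W.externalCup X Y h x z ∈ W.algebraicClasses (X ⊗ Y) p := by
  obtain ⟨t, rfl⟩ := W.exists_eq_smul_one hX x
  rw [LinearMap.map_smul₂, W.externalCup_one_left hX hY h z]
  exact Submodule.smul_mem _ t
    (W.map_algebraicClasses_le (isSmoothProjective_tensor hX hY) hY (snd X Y) p ⟨z, hz, rfl⟩)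

/-- An external product with a degree-zero right factor is algebraic when its left factor is.
[cite: Kleiman1968, §1.2 (C)] -/
theorem externalCup_mem_algebraicClasses_of_deg_zero_right (hX : IsSmoothProjective n X)
    (hY : IsSmoothProjective m Y) {p : ℕ} (h : 2 * p + 0 = 2 * p) {x : W.obj X (2 * p)}
    (hx : x ∈ W.algebraicClasses X p) (y : W.obj Y 0) :
    W.externalCup X Y h x y ∈ W.algebraicClasses (X ⊗ Y) p := by
  obtain ⟨t, rfl⟩ := W.exists_eq_smul_one hY y
  rw [map_smul, W.externalCup_one_right hX hY h x]
  exact Submodule.smul_mem _ t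
    (W.map_algebraicClasses_le (isSmoothProjective_tensor hX hY) hX (fst X Y) p ⟨x, hx, rfl⟩)

/-- **Künneth in degree one**: every class in `H¹(X × Y)` is `pr₁* x + pr₂* y` with `x ∈ H¹(X)`,
`y ∈ H¹(Y)` (`H⁰ = K · 1` on both factors; Kleiman 1968, §1.2 (B)). [cite: Kleiman1968, §1.2 (B)] -/
theorem exists_eq_pullback_add_pullback (hX : IsSmoothProjective n X) (hY : IsSmoothProjective m Y)
    (w : W.obj (X ⊗ Y) 1) :
    ∃ (x : W.obj X 1) (y : W.obj Y 1),
      w = W.pullback (fst X Y) 1 x + W.pullback (snd X Y) 1 y := by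
  induction w using W.kunneth_induction hX hY with
  | zero => exact ⟨0, 0, by simp⟩
  | add w w' hw hw' =>
    obtain ⟨x, y, rfl⟩ := hw
    obtain ⟨x', y', rfl⟩ := hw'
    exact ⟨x + x', y + y', by simp only [map_add]; abel⟩
  | ext a a' ha x y =>
    obtain rfl | rfl : a = 0 ∨ a = 1 := by omega
    · obtain rfl : a' = 1 := by omega
      obtain ⟨t, rfl⟩ := W.exists_eq_smul_one hX x
      refine ⟨0, t • y, ?_⟩
      rw [LinearMap.map_smul₂, W.externalCup_one_left hX hY ha y, map_zero, zero_add, map_smul]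
    · obtain rfl : a' = 0 := by omega
      obtain ⟨t, rfl⟩ := W.exists_eq_smul_one hY y
      refine ⟨t • x, 0, ?_⟩
      rw [map_smul, W.externalCup_one_right hX hY ha x, map_zero, add_zero, map_smul]

/-- **Divisor classes on a product.** If the `K`-spans of the divisor classes exhaust `H²(X)` and
`H²(Y)` and contain the external products `pr₁* x ∪ pr₂* y` of degree-one classes, then they
exhaust `H²(X × Y)` (Künneth in degree `2`: `H² ⊗ H⁰ ⊕ H¹ ⊗ H¹ ⊕ H⁰ ⊗ H²`; the outer parts are
`pr₁* H²(X)`, `pr₂* H²(Y)`). [cite: Kleiman1968, §1.2 (B)] -/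
theorem algebraicClasses_tensor_one_eq_top (hX : IsSmoothProjective n X)
    (hY : IsSmoothProjective m Y) (hX1 : W.algebraicClasses X 1 = ⊤)
    (hY1 : W.algebraicClasses Y 1 = ⊤)
    (hmixed : ∀ (x : W.obj X 1) (y : W.obj Y 1),
      W.externalCup X Y (show 1 + 1 = 2 * 1 by rfl) x y ∈ W.algebraicClasses (X ⊗ Y) 1) :
    W.algebraicClasses (X ⊗ Y) 1 = ⊤ := by
  rw [eq_top_iff]
  rintro w -
  induction w using W.kunneth_induction hX hY with
  | zero => exact zero_mem _
  | add w w' hw hw' => exact add_mem hw hw'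
  | ext a a' ha x y =>
    obtain rfl | rfl | rfl : a = 0 ∨ a = 1 ∨ a = 2 := by omega
    · obtain rfl : a' = 2 * 1 := by omega
      exact W.externalCup_mem_algebraicClasses_of_deg_zero_left hX hY ha x (by rw [hY1]; trivial)
    · obtain rfl : a' = 1 := by omega
      exact hmixed x y
    · obtain rfl : a' = 0 := by omega
      exact W.externalCup_mem_algebraicClasses_of_deg_zero_right hX hY (p := 1) ha
        (by rw [hX1]; trivial) y

end Products

end WeilCohomology

end Literature.AlgebraicGeometry.Motives

end
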